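import Literature.Computability.AlgebraicComplexity.DeterminantalComplexity
import Literature.Computability.AlgebraicComplexity.StandardFamiliesProofs
import Literature.Computability.AlgebraicComplexity.RankOneDeterminantalExpressionsProofs

/-!
# `UlrichPadded.OrbitCorankTwo` (stmt-ValiantsHypothesis-15032): affineness of the INPUT is load-bearing

Negative knowledge for the crux (standing disprover, cycle 1, 2026-08-16).  The crux quantifies over
AFFINE determinantal representations `A` of `per_n` (`IsAffineDetRepr`: entries of total degree `≤ 1`,
`det A = per_n`) and produces an affine gauge form `P·A·Q` with padding order `j ≥ 1`.  If the input
hypothesis is weakened to `det A = per_n` (entries of any degree), the statement becomes FALSE for the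
cheapest reason: below size `n` there is no affine representation at all (an `m × m` affine determinant
has degree `≤ m`), while `det = per_n` has solutions of every size `m ≥ 1`, e.g. the `1 × 1` matrix
`(per_n)`.  So 'every square matrix with `det = per_n` is `GL_m(ℂ[x])²`-equivalent to an affine one'
(a Smith-normal-form statement, cf. crux card vdk-window-collapse) is a different claim that can only
hold from `m ≥ dc(per_n)` on; the crux itself never leaves the affine locus.  Inline statement (the
ledger signature of stmt-ValiantsHypothesis-15032 with `IsAffineDetRepr … A →` replaced by
`A.det = perPoly (Fin n) ℂ →`), Literature-only imports, no new facts.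
-/

noncomputable section

namespace Summit.ValiantsHypothesis.Theorems.OrbitCorankTwoNegative

open MvPolynomial Matrix
open Literature.Computability.AlgebraicComplexity

/-- **Affineness of the input representation is load-bearing in `OrbitCorankTwo`.**  With
`IsAffineDetRepr (perPoly (Fin n) ℂ) A` weakened to `A.det = perPoly (Fin n) ℂ` the crux is false:
witness `n = 3`, `m = 1`, `A = (per₃)`; a gauge form `P·A·Q` is again `1 × 1` with `det = ` its entry
`= per₃` of total degree `3 > 1`, so it is never affine. [folklore] -/
theorem orbitCorankTwo_false_nonaffine_input :
    ¬ ∀ n : ℕ, 3 ≤ n → ∀ (m : ℕ) (A : Matrix (Fin m) (Fin m) (MvPolynomial (Fin n × Fin n) ℂ)),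
      A.det = perPoly (Fin n) ℂ →
      ∃ P Q : Matrix (Fin m) (Fin m) (MvPolynomial (Fin n × Fin n) ℂ), IsUnit P ∧ IsUnit Q ∧
        IsAffineDetRepr (perPoly (Fin n) ℂ) (P * A * Q) ∧
        ∀ i j, (Matrix.of fun a b => homogeneousComponent 1 ((P * A * Q) a b)).adjugate i j ∈
          Ideal.span {perPoly (Fin n) ℂ} := by
  intro h
  obtain ⟨A, hA⟩ : ∃ M : Matrix (Fin 1) (Fin 1) (MvPolynomial (Fin 3 × Fin 3) ℂ),
      M = !![perPoly (Fin 3) ℂ] := ⟨_, rfl⟩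
  have hdet : A.det = perPoly (Fin 3) ℂ := by
    rw [hA, Matrix.det_fin_one]
    rfl
  obtain ⟨P, Q, -, -, ⟨hdeg, hdet'⟩, -⟩ := h 3 le_rfl 1 A hdet
  have hper : perPoly (Fin 3) ℂ ≠ 0 := perPoly_ne_zero (Fin 3) ℂ
  have hdegper : (perPoly (Fin 3) ℂ).totalDegree = 3 := by
    simpa [Fintype.card_fin] using
      (perPoly_isHomogeneous (n := Fin 3) (k := ℂ)).totalDegree hper
  have h00 : (P * A * Q) 0 0 = perPoly (Fin 3) ℂ := by
    rw [← hdet', Matrix.det_fin_one]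
  have := hdeg 0 0
  rw [h00, hdegper] at this
  omega

end Summit.ValiantsHypothesis.Theorems.OrbitCorankTwoNegative
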